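/-
Copyright: statement-level skeleton of a published paper (lit-balaban cell, Phase-2 proof seat p32 gen 40). No proof claims
beyond what the kernel checks below.
-/
import Literature.MathematicalPhysics.QuantumFieldTheory.Balaban1983to89.B3Ineq31RegularTorus
import Literature.MathematicalPhysics.QuantumFieldTheory.Balaban1983to89.HiggsGaugeInvariance
import Literature.MathematicalPhysics.QuantumFieldTheory.Balaban1983to89.B1Ineq234Concrete

/-!
# B3 — T. Bałaban, *(Higgs)₂,₃ quantum fields in a finite volume. III. Renormalization*, CMP **88** (1983) 411–445
[Balaban1983Higgs3], p. 420 [PDF 10], display **(1.32)** — THE NORM `‖f‖_{1,α}` OF A SCALAR FIELD OF ONE VARIABLE AT A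
GENERAL BACKGROUND `B̃` ON THE CONCRETE (Higgs)₂,₃ TORUS CARRIER, WITH THE «SHORTEST CONTOUR» CLAUSE PROVED:
*"For a scalar field f of one variable we define ‖f‖_{1,α} = sup_x |f(x)| + sup_{x,μ} |(D^η_{B̃,μ}f)(x)| + sup_{x,x′,μ} |x − x′|^{−α}
|U(B̃(Γ_{x,x′}))(D^η_{B̃,μ}f)(x′) − (D^η_{B̃,μ}f)(x)|, (1.32) where Γ_{x,x′} is a shortest contour connecting x and x′. This definition
extends in a natural way to functions of many variables. For external vector fields we have the same definition, but with B̃ = 0."*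

statement-level skeleton of published theorems with citation tags; proofs where landed; nothing here is a claim about
the Yang–Mills mass gap

PDF held: `paper:balaban1983-higgs-2-3-quantum-fields-finite-volume` (journal page = PDF page + 410); p. 420 [PDF 10] read in the
OCR text layer `p0010.txt` (display legible up to OCR noise; the owner r15 re-read the ×2 render 2026-08-23T06:45Z and quoted it to
this seat verbatim, `HOME/lit-balaban-p32/INBOX.md` 06:44:00Z).  Row **B3.Eq1.32** of `HOME/lit-balaban-r15/ROWS-B3.md` (fold owner
r15; decl of record `B3Sect1Statements.norm132` = the printed SUM form with the derivative family / transport / distance SUPPLIED;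
head `typed p239840`).  CONTEXT (ROWS-B3 v1.278 cell): (1.32) over `norm132` is instantiated in the tree (i) at `B̃ = 0` (identity
transports), (ii) at a CONSTANT `B̃₀` on pieces of `ηℤ^{d+1}` with [B4]'s links (p03 `B3Norm132ConstGauge.norm132A`, the p. 434 gauge
identity `norm132A_constBond_eq_gaugeOut`, p304514), (iii) for the TWO-variable propagator fields at a regular non-constant `A`
(p40 `B3Ineq31RegularTorus.normHGH`/`transp`, `B3Ineq31RegularRegion.normHGHR`, p33 `B3Ineq25RegularNested.normHGHD`).  What was
not in the tree: the ONE-variable literal (1.32) at a GENERAL `B̃` on the concrete torus carrier, and the clause «Γ_{x,x′} is a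
shortest contour» as a theorem (p26/p40 record `|Γ_{x,x′}| ≤ d·|x − x′|_∞` only).  THIS FILE:
* §1 THE SHORTEST CONTOUR.  `cdist`/`l1dist` — the coordinatewise and the ℓ¹ («number of bonds») torus distances of `T^{(k)}`;
  `l1dist_triangle`, `tdist_le_l1dist`, `l1dist_le_card_mul_tdist`; **`l1dist_pathEnd_le_length`** — EVERY nearest-neighbour chain
  `Γ` from `x` (p35's `B1TorusChainTransport.IsTChain`) satisfies `l1dist x (end Γ) ≤ |Γ|`; **`length_cpath`** — p40's contour of record
  `cpath x x′` (p26's coordinatewise path `legs x′ x (0,…,d−1)`: the coordinates walked in the order `0, 1, …, d−1`, each along its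
  shorter arc of the cycle, ties forward) has EXACTLY `l1dist x x′` bonds; hence **`length_cpath_le_of_isTChain`**: `cpath x x′` IS A
  SHORTEST CONTOUR connecting `x` and `x′` — the printed clause.  Print fixes A shortest contour (not unique); the tree's choice is
  `cpath`, and (1.32) depends on the choice only through the transport `U(B̃(Γ_{x,x′}))` (no choice-independence is claimed: at a
  non-flat `B̃` different shortest contours give different transports).
* §2 **(1.32) WITH A BODY at a general `B̃`**: on the fine torus `T_η` (sites `HiggsLattice.Site P 0`, read in the print's `η`-units of
  the step `k`, `η = L^{−k}`: neighbouring sites at distance `η`, p40's convention `pdist`) for `f : T_η → ℝ^N` and a background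
  `B̃` given by its link variables `U(B̃_b) = C.U ε (A b)` (the rescaling-invariant group elements of the `ε`-lattice field `A`,
  p. 412): `dEta C A k f (μ,x) = (D^η_{B̃,μ}f)(x) = η^{−1}(U(B̃_{⟨x,x+ηe_μ⟩})f(x+ηe_μ) − f(x))` (`= (L^kε)·covDeriv C A f ⟨x,μ⟩`,
  `dEta_eq_smul_covDeriv`), `tau132 C A (μ,x) (μ′,x′) = U(B̃(Γ_{x,x′}))` = p35's `hol C A x (cpath x x′)` (the SAME contour convention
  as p40's two-variable `transp C A` = `hol ∘ · ∘ hol^*` along `cpath` in each variable — one convention for (1.32) in the tree),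
  `dist132 k (μ,x) (μ′,x′) = |x − x′| = η·tdist x x′` ((I.1.3) in `η`-units), and **`norm132B C A k α f`** := r15's `norm132` fed with
  these over ALL sites and ALL pairs `(μ,x)`, same direction `μ = μ′` in the Hölder supremum — the display verbatim; API
  `norm_apply_le_norm132B`, `norm_dEta_le_norm132B`, `holder_le_norm132B` (the three defining bounds), `norm132B_nonneg`.
* §3 **«For external vector fields we have the same definition, but with B̃ = 0»**: `dPlain k F` (plain `η`-differences) and
  **`norm132V k α F`** for a field `F : T_η → V` with values in any normed space (external vector fields: `V = ℝ^d` components, or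
  bond functions read at `b₋`), identity transports; **`norm132B_zero`**: at `B̃ = 0` the scalar-field norm IS `norm132V`
  (`U(0) = 1`: `dEta_zero`, `hol_zero`/`tau132_zero`).
* §4 **GAUGE INVARIANCE at a general `B̃`** (the mechanism behind p. 433 «gauge-invariant with respect to gauge transformations of
  the field B̃₀, if the external scalar fields are simultaneously transformed» / p. 434, here for ANY `B̃` on the torus, `|T|_μ > 2`):
  `bondVal_grad_of_tNbr`, `pathSum_bondVal_grad` (the gradient telescopes along every chain), **`hol_gaugeVec`**
  (`U((B̃−∂λ)(Γ)) = U(λ(x))U(B̃(Γ))U(λ(end Γ))^{−1}`), `dEta_gauge`, and **`norm132B_gauge`**: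
  `‖U(λ)f‖_{1,α}[B̃ − ∂^ηλ] = ‖f‖_{1,α}[B̃]` summand by summand (typer's `HiggsGaugeInvariance.{gaugeVec, rot, covDeriv_gauge}`).
HONEST SCOPE.  (i) One-variable scalar fields on the whole fine torus `T_η` of the (Higgs)₂,₃ family (`HiggsLattice`, any `d`, `N`,
abelian one-parameter links (I.1.7)); localized external fields are the case of an `f` supported near `□(v)` — the suprema run over
all sites as printed.  (ii) «extends in a natural way to functions of many variables»: NOT re-typed here — the tree's reading of
record is p40's/p33's two-variable `normHGH`/`normHGHR`/`normHGHD` over the same `norm132` with `transp C A` built from the same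
`hol ∘ cpath` (see (iii) of CONTEXT); this file's `tau132` is its one-variable factor.  (iii) The constant-`B̃₀` gauge identity of
p. 434 on [B4]'s `ηℤ^{d+1}` pieces stays p03's `norm132A_constBond_eq_gaugeOut`; §4 is the torus statement at a general `B̃` for
gauge functions `λ : T → ℝ` (periodic), which does not remove a constant field on the torus (holonomy) — consistent with p03's
scope note (ii).  (iv) Units: print's `η`-lattice objects are represented on `Site P 0` with the factor `L^k = η^{−1}` in `D^η` and
`η·tdist` as `|x − x′|`, exactly p40's `pdist`/`unitD` convention; nothing is claimed about the field-strength rescaling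
`(L^kε)^{(d−2)/2}` of p. 412 (a norm of a given function `f`).  Definitions with bodies + theorems; no `Prop`-valued definition, no
named fact; Mathlib + the cited tree files; standard axioms.  Unit `lit-balaban-p32` (Phase-2 proof seat p32, gen 40), HOME
`run/shared/lean/pub/lit-balaban/`, 2026-08-23.
-/

open scoped BigOperators
open Finset

namespace Literature.MathematicalPhysics.QuantumFieldTheory.Balaban1983to89.B3Norm132Covariant

open B4GaugeCovariance (pathEnd)
open B4Lemma22HolderBox (pathSum)
open B1TorusChainTransport (TNbr IsTChain bondVal hol hol_nil hol_cons norm_hol_apply bondVal_shift bondVal_of_shift)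
open B3Ineq211RegularTorus (leg legs length_leg isTChain_legs pathEnd_legs)
open B3Ineq31RegularTorus (cpath isAdm_cpath pathEnd_cpath cpath_self)
open B3Sect1Statements (norm132 norm132_nonneg)
open LatticeNorms (supNorm holderSeminorm norm_le_supNorm holder_bound supNorm_nonneg holderSeminorm_nonneg)
open HiggsGaugeInvariance (gaugeVec rot covDeriv_gauge norm_U)
open HiggsHodgeIdentity (grad)
open B1Ineq234Concrete (toT periods one_le_periods circAbs_val_sub)
open B1Ineq234LevelZero (tdist_comm)
open B1Ineq234Concrete (tdist_self)

noncomputable section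

variable {P : HiggsLattice.Params} {N : ℕ}

/-! ## §1 The shortest contour: the ℓ¹ torus distance and the length of `cpath` -/

section Shortest

variable {k : ℕ}

/-- The `μ`-th coordinate distance of two sites of `T^{(k)}`: the shorter arc `min{(x_μ − y_μ) mod, (y_μ − x_μ) mod}` of the `μ`-th
cycle (the summand of p26's `length_leg`; the coordinate term of (I.1.3)). [cite: Balaban1982Higgs1, (1.3) p.604] -/
def cdist (x y : HiggsLattice.Site P k) (μ : Fin P.d) : ℕ := min (x μ - y μ).val (y μ - x μ).val

/-- **The ℓ¹ torus distance** `Σ_μ dist_μ(x,y)` = the smallest number of bonds of a contour from `x` to `y` (below: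
`l1dist_pathEnd_le_length` and `length_cpath`) — the length scale of «a shortest contour connecting x and x′».
[cite: Balaban1983Higgs3, (1.32) p.420] -/
def l1dist (x y : HiggsLattice.Site P k) : ℕ := ∑ μ : Fin P.d, cdist x y μ

/-- kernel: the coordinate distance is the §5-engine's circular coordinate distance under the chart `toT` (r14's
`circAbs_val_sub`). [cite: Balaban1982Higgs1, (1.3) p.604] -/
theorem ccoord_toT (x y : HiggsLattice.Site P k) (μ : Fin P.d) : B4Sect5Torus.ccoord (periods P k) (toT x) (toT y) μ = cdist x y μ := by
  simp only [B4Sect5Torus.ccoord, toT, cdist]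
  exact circAbs_val_sub (x μ) (y μ)

/-- the coordinate distance is symmetric. [cite: Balaban1982Higgs1, (1.3) p.604] -/
theorem cdist_comm (x y : HiggsLattice.Site P k) (μ : Fin P.d) : cdist x y μ = cdist y x μ := by
  unfold cdist; rw [min_comm]

/-- the coordinate distance vanishes on the diagonal. [cite: Balaban1982Higgs1, (1.3) p.604] -/
theorem cdist_self (x : HiggsLattice.Site P k) (μ : Fin P.d) : cdist x x μ = 0 := by simp [cdist]

/-- the coordinate distance satisfies the triangle inequality (the engine's `ccoord_triangle`). [cite: Balaban1982Higgs1, (1.3) p.604] -/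
theorem cdist_triangle (x y z : HiggsLattice.Site P k) (μ : Fin P.d) : cdist x z μ ≤ cdist x y μ + cdist y z μ := by
  rw [← ccoord_toT, ← ccoord_toT, ← ccoord_toT]
  exact B4Sect5Torus.ccoord_triangle (one_le_periods P k) _ _ _ μ

/-- coordinates that agree contribute nothing. [cite: Balaban1982Higgs1, (1.3) p.604] -/
theorem cdist_eq_zero_of_eq {x y : HiggsLattice.Site P k} {μ : Fin P.d} (h : x μ = y μ) : cdist x y μ = 0 := by
  simp [cdist, h]

/-- each coordinate distance is below the (I.1.3) sup-distance (p26's `coordDist_le_tdist`, any level). [cite: Balaban1982Higgs1, (1.3) p.604] -/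
theorem cdist_le_tdist (x y : HiggsLattice.Site P k) (μ : Fin P.d) : cdist x y μ ≤ HiggsLattice.Site.tdist x y :=
  Finset.le_sup (f := fun ν : Fin P.d => min (x ν - y ν).val (y ν - x ν).val) (Finset.mem_univ μ)

/-- `l1dist` is symmetric. [cite: Balaban1983Higgs3, (1.32) p.420] -/
theorem l1dist_comm (x y : HiggsLattice.Site P k) : l1dist x y = l1dist y x := by
  unfold l1dist; exact Finset.sum_congr rfl fun μ _ => cdist_comm x y μ

/-- `l1dist x x = 0`. [cite: Balaban1983Higgs3, (1.32) p.420] -/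
theorem l1dist_self (x : HiggsLattice.Site P k) : l1dist x x = 0 := by simp [l1dist, cdist_self]

/-- `l1dist` satisfies the triangle inequality. [cite: Balaban1983Higgs3, (1.32) p.420] -/
theorem l1dist_triangle (x y z : HiggsLattice.Site P k) : l1dist x z ≤ l1dist x y + l1dist y z := by
  unfold l1dist; rw [← Finset.sum_add_distrib]; exact Finset.sum_le_sum fun μ _ => cdist_triangle x y z μ

/-- the (I.1.3) sup-distance is below the ℓ¹ distance. [cite: Balaban1982Higgs1, (1.3) p.604] -/
theorem tdist_le_l1dist (x y : HiggsLattice.Site P k) : HiggsLattice.Site.tdist x y ≤ l1dist x y := by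
  unfold HiggsLattice.Site.tdist l1dist
  refine Finset.sup_le fun μ _ => ?_
  exact Finset.single_le_sum (f := fun ν => cdist x y ν) (fun ν _ => Nat.zero_le _) (Finset.mem_univ μ)

/-- and the ℓ¹ distance is at most `d` times the sup-distance. [cite: Balaban1982Higgs1, (1.3) p.604] -/
theorem l1dist_le_card_mul_tdist (x y : HiggsLattice.Site P k) : l1dist x y ≤ P.d * HiggsLattice.Site.tdist x y := by
  unfold l1dist
  calc ∑ μ : Fin P.d, cdist x y μ ≤ ∑ _μ : Fin P.d, HiggsLattice.Site.tdist x y := Finset.sum_le_sum fun μ _ => cdist_le_tdist x y μ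
    _ = P.d * HiggsLattice.Site.tdist x y := by rw [Finset.sum_const, Finset.card_univ, Fintype.card_fin, smul_eq_mul]

/-- one lattice step has ℓ¹ length at most `1`: `l1dist x (x + e_μ) ≤ 1`. [cite: Balaban1982Higgs1, (1.2) p.604] -/
theorem l1dist_shift_le_one (x : HiggsLattice.Site P k) (μ : Fin P.d) : l1dist x (x.shift μ) ≤ 1 := by
  unfold l1dist
  rw [← Finset.sum_erase_add _ _ (Finset.mem_univ μ)]
  have h0 : ∑ ν ∈ Finset.univ.erase μ, cdist x (x.shift μ) ν = 0 := by
    refine Finset.sum_eq_zero fun ν hν => cdist_eq_zero_of_eq ?_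
    rw [HiggsLattice.Site.shift, Function.update_of_ne (Finset.ne_of_mem_erase hν)]
  rw [h0, zero_add]
  calc cdist x (x.shift μ) μ ≤ (x.shift μ μ - x μ).val := min_le_right _ _
    _ = (1 : ZMod (P.sitesPerDir k μ)).val := by rw [HiggsLattice.Site.shift, Function.update_self, add_sub_cancel_left]
    _ ≤ 1 := by rw [ZMod.val_one_eq_one_mod]; exact Nat.mod_le 1 _

/-- lattice neighbours are at ℓ¹ distance at most `1`. [cite: Balaban1983RegularityDecay, p.572] -/
theorem l1dist_le_one_of_tNbr {x y : HiggsLattice.Site P k} (h : TNbr x y) : l1dist x y ≤ 1 := by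
  obtain ⟨μ, rfl | rfl⟩ := h
  · exact l1dist_shift_le_one x μ
  · rw [l1dist_comm]; exact l1dist_shift_le_one y μ

/-- **every contour is at least as long as the ℓ¹ distance of its ends**: for a nearest-neighbour chain `Γ` from `x`,
`l1dist x (end Γ) ≤ |Γ|`. [cite: Balaban1983Higgs3, (1.32) p.420] -/
theorem l1dist_pathEnd_le_length {x : HiggsLattice.Site P k} {l : List (HiggsLattice.Site P k)} (hl : IsTChain x l) :
    l1dist x (pathEnd x l) ≤ l.length := by
  induction l generalizing x with
  | nil => simp [pathEnd, l1dist_self]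
  | cons y l ih =>
      obtain ⟨hxy, hl'⟩ := hl
      rw [pathEnd, List.length_cons]
      calc l1dist x (pathEnd y l) ≤ l1dist x y + l1dist y (pathEnd y l) := l1dist_triangle _ _ _
        _ ≤ 1 + l.length := Nat.add_le_add (l1dist_le_one_of_tNbr hxy) (ih hl')
        _ = l.length + 1 := add_comm _ _

/-- hence: a chain from `x` to `y` has at least `l1dist x y` bonds. [cite: Balaban1983Higgs3, (1.32) p.420] -/
theorem l1dist_le_length_of_isTChain {x y : HiggsLattice.Site P k} {l : List (HiggsLattice.Site P k)} (hl : IsTChain x l) (hend : pathEnd x l = y) :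
    l1dist x y ≤ l.length := hend ▸ l1dist_pathEnd_le_length hl

/-- kernel: the length of p26's coordinatewise path through the coordinates `ms` (no repetitions), started at a point `x′` agreeing
with `x` on `ms`, is `Σ_{μ ∈ ms} dist_μ(x,y)`. [cite: Balaban1982Higgs1, (1.3) p.604] -/
theorem length_legs_eq (x y : HiggsLattice.Site P 0) : ∀ (x' : HiggsLattice.Site P 0) (ms : List (Fin P.d)), ms.Nodup → (∀ ν ∈ ms, x' ν = x ν) →
    (legs y x' ms).length = ∑ μ ∈ ms.toFinset, cdist x y μ
  | x', [], _, _ => by simp [legs]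
  | x', μ :: ms, hnd, hx' => by
    have hμ : μ ∉ ms := (List.nodup_cons.mp hnd).1
    have hnd' : ms.Nodup := (List.nodup_cons.mp hnd).2
    rw [legs, List.length_append, List.toFinset_cons, Finset.sum_insert (by rwa [List.mem_toFinset]), length_leg,
      hx' μ List.mem_cons_self]
    congr 1
    refine length_legs_eq x y _ ms hnd' fun ν hν => ?_
    have hne : ν ≠ μ := fun h => hμ (h ▸ hν)
    rw [Function.update_of_ne hne]
    exact hx' ν (List.mem_cons_of_mem μ hν)

/-- **`|Γ_{x,x′}| = l1dist x x′`**: p40's contour of record `cpath x x′` (coordinates `0, …, d−1` in turn, each along its shorter arc)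
has exactly `Σ_μ dist_μ(x,x′)` bonds. [cite: Balaban1983Higgs3, (1.32) p.420] -/
theorem length_cpath (x x' : HiggsLattice.Site P 0) : (cpath x x').length = l1dist x x' := by
  rw [cpath, length_legs_eq x x' x (List.finRange P.d) (List.nodup_finRange P.d) fun ν _ => rfl, l1dist]
  refine Finset.sum_congr ?_ fun μ _ => rfl
  ext μ; simp

/-- **«Γ_{x,x′} is a shortest contour connecting x and x′» — PROVED for the tree's `Γ_{x,x′} = cpath x x′`**: every nearest-neighbour
chain from `x` to `x′` has at least as many bonds. [cite: Balaban1983Higgs3, (1.32) p.420] -/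
theorem length_cpath_le_of_isTChain {x x' : HiggsLattice.Site P 0} {l : List (HiggsLattice.Site P 0)} (hl : IsTChain x l) (hend : pathEnd x l = x') :
    (cpath x x').length ≤ l.length := by
  rw [length_cpath]; exact l1dist_le_length_of_isTChain hl hend

/-- `cpath x x′` itself is a nearest-neighbour chain from `x` to `x′` (p40's `isAdm_cpath`), so the minimum is attained.
[cite: Balaban1983Higgs3, (1.32) p.420] -/
theorem isTChain_cpath (x x' : HiggsLattice.Site P 0) : IsTChain x (cpath x x') ∧ pathEnd x (cpath x x') = x' :=
  ⟨(isAdm_cpath x x').1, (isAdm_cpath x x').2.1⟩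

/-- the shortest-contour length in closed form: `min {|Γ| : Γ from x to x′} = l1dist x x′`, attained by `cpath`.
[cite: Balaban1983Higgs3, (1.32) p.420] -/
theorem l1dist_eq_length_shortest (x x' : HiggsLattice.Site P 0) :
    l1dist x x' = (cpath x x').length ∧ ∀ l : List (HiggsLattice.Site P 0), IsTChain x l → pathEnd x l = x' → l1dist x x' ≤ l.length :=
  ⟨(length_cpath x x').symm, fun _ hl hend => l1dist_le_length_of_isTChain hl hend⟩

end Shortest

/-! ## §2 (1.32) with a body at a general background `B̃` on the torus -/

section Norm

variable (C : HiggsLattice.ChargeData N) (A : HiggsLattice.VecField P 0) (k : ℕ)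

/-- The index of a derivative value: a direction and a site, `(μ, x)` ↔ the bond `⟨x, x + ηe_μ⟩`. [cite: Balaban1983Higgs3, (1.32) p.420] -/
abbrev DIdx (P : HiggsLattice.Params) : Type := Fin P.d × HiggsLattice.Site P 0

/-- **`(D^η_{B̃,μ}f)(x) = η^{−1}(U(B̃_{⟨x,x+ηe_μ⟩})f(x + ηe_μ) − f(x))`** in the print's `η`-units of the step `k` (`η^{−1} = L^k`; the link
variable of the bond is the rescaling-invariant `U(B̃_b) = C.U ε (A b)` of the `ε`-lattice field `A`, p. 412).
[cite: Balaban1983Higgs3, (1.32) p.420] -/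
def dEta (f : HiggsLattice.ScalarField P 0 N) : DIdx P → EuclideanSpace ℝ (Fin N) :=
  fun p => ((P.L : ℝ) ^ k) • (C.U (P.mesh 0) (A ⟨p.2, p.1⟩) (f (p.2.shift p.1)) - f p.2)

/-- dictionary: `D^η_{B̃,μ}f = (L^kε)·D^ε_{A,μ}f` — the lineage's covariant derivative `HiggsLattice.covDeriv` (I.1.7) rescaled to
`η`-units. [cite: Balaban1983Higgs3, (1.32) p.420] -/
theorem dEta_eq_smul_covDeriv (f : HiggsLattice.ScalarField P 0 N) (p : DIdx P) :
    dEta C A k f p = ((P.L : ℝ) ^ k * P.mesh 0) • HiggsLattice.covDeriv C A f ⟨p.2, p.1⟩ := by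
  have hε : P.mesh 0 ≠ 0 := (P.mesh_pos 0).ne'
  rw [dEta, HiggsLattice.covDeriv, smul_smul, mul_assoc, mul_inv_cancel₀ hε, mul_one]
  rfl

/-- **the transport `U(B̃(Γ_{x,x′}))`** of (1.32), carrying a derivative value at `x′` back to `x` along THE shortest contour
`Γ_{x,x′} = cpath x x′` of §1 (p35's `hol` = the ordered product of the link variables along the chain; the same contour
convention as p40's two-variable `transp C A`). [cite: Balaban1983Higgs3, (1.32) p.420] -/
def tau132 (p q : DIdx P) (v : EuclideanSpace ℝ (Fin N)) : EuclideanSpace ℝ (Fin N) := hol C A p.2 (cpath p.2 q.2) v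

/-- bridge: `tau132` IS p35's holonomy `U(B̃(Γ))` along p40's contour of record `cpath` — literally the first factor
`hol C A x (cpath x x′)` of p40's two-variable transport `B3Ineq31RegularTorus.transp C A` (one contour convention for (1.32) in the
tree). [cite: Balaban1983Higgs3, (1.32) p.420] -/
theorem tau132_eq_hol (p q : DIdx P) (v : EuclideanSpace ℝ (Fin N)) : tau132 C A p q v = hol C A p.2 (cpath p.2 q.2) v := rfl

/-- the transport is an isometry (`U` unitary). [cite: Balaban1983Higgs3, (1.32) p.420] -/
theorem norm_tau132 (p q : DIdx P) (v : EuclideanSpace ℝ (Fin N)) : ‖tau132 C A p q v‖ = ‖v‖ := norm_hol_apply C A _ _ v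

/-- `|x − x′|` of (1.32): the torus distance (I.1.3) in `η`-units, `η·tdist x x′ = tdist x x′/L^k` (p40's `pdist` on one variable).
[cite: Balaban1983Higgs3, (1.32) p.420] -/
def dist132 (k : ℕ) (p q : DIdx P) : ℝ := (HiggsLattice.Site.tdist p.2 q.2 : ℝ) / (P.L : ℝ) ^ k

/-- the Hölder supremum of (1.32) compares derivative values of the SAME direction `μ` at two sites `x, x′`. [cite: Balaban1983Higgs3, (1.32) p.420] -/
def SameDir (p q : DIdx P) : Prop := p.1 = q.1

/-- **(1.32)**: `‖f‖_{1,α} = sup_x|f(x)| + sup_{x,μ}|(D^η_{B̃,μ}f)(x)| + sup_{x,x′,μ}|x − x′|^{−α}|U(B̃(Γ_{x,x′}))(D^η_{B̃,μ}f)(x′) − (D^η_{B̃,μ}f)(x)|`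
for a scalar field `f : T_η → ℝ^N` at the background `B̃` (links `U(B̃_b) = C.U ε (A b)`) — r15's printed SUM form `norm132` fed with
`dEta`, `tau132`, `dist132`, over all sites and all `(μ, x)`. [cite: Balaban1983Higgs3, (1.32) p.420] -/
def norm132B (α : ℝ) (f : HiggsLattice.ScalarField P 0 N) : ℝ :=
  norm132 α SameDir (dist132 k) (tau132 C A) Finset.univ Finset.univ f (dEta C A k f)

/-- unfolding: (1.32) is the sum of the three printed suprema. [cite: Balaban1983Higgs3, (1.32) p.420] -/
theorem norm132B_eq (α : ℝ) (f : HiggsLattice.ScalarField P 0 N) :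
    norm132B C A k α f = supNorm Finset.univ f + supNorm Finset.univ (dEta C A k f) +
      holderSeminorm α SameDir (dist132 k) (tau132 C A) Finset.univ (dEta C A k f) := rfl

/-- `‖f‖_{1,α} ≥ 0`. [cite: Balaban1983Higgs3, (1.32) p.420] -/
theorem norm132B_nonneg (α : ℝ) (f : HiggsLattice.ScalarField P 0 N) : 0 ≤ norm132B C A k α f := norm132_nonneg _ _ _ _ _ _ _ _

/-- first defining bound: `|f(x)| ≤ ‖f‖_{1,α}`. [cite: Balaban1983Higgs3, (1.32) p.420] -/
theorem norm_apply_le_norm132B (α : ℝ) (f : HiggsLattice.ScalarField P 0 N) (x : HiggsLattice.Site P 0) : ‖f x‖ ≤ norm132B C A k α f := by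
  rw [norm132B_eq]
  have h1 := norm_le_supNorm f (Finset.mem_univ x) (S := Finset.univ)
  have h2 := supNorm_nonneg Finset.univ (dEta C A k f)
  have h3 := holderSeminorm_nonneg α SameDir (dist132 k) (tau132 C A) Finset.univ (dEta C A k f)
  linarith

/-- second defining bound: `|(D^η_{B̃,μ}f)(x)| ≤ ‖f‖_{1,α}`. [cite: Balaban1983Higgs3, (1.32) p.420] -/
theorem norm_dEta_le_norm132B (α : ℝ) (f : HiggsLattice.ScalarField P 0 N) (p : DIdx P) : ‖dEta C A k f p‖ ≤ norm132B C A k α f := by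
  rw [norm132B_eq]
  have h1 := norm_le_supNorm (dEta C A k f) (Finset.mem_univ p) (S := Finset.univ)
  have h2 := supNorm_nonneg Finset.univ f
  have h3 := holderSeminorm_nonneg α SameDir (dist132 k) (tau132 C A) Finset.univ (dEta C A k f)
  linarith

/-- third defining bound: for `x ≠ x′`, `|U(B̃(Γ_{x,x′}))(D^η_{B̃,μ}f)(x′) − (D^η_{B̃,μ}f)(x)| ≤ ‖f‖_{1,α}·|x − x′|^α`.
[cite: Balaban1983Higgs3, (1.32) p.420] -/
theorem holder_le_norm132B (α : ℝ) (f : HiggsLattice.ScalarField P 0 N) (μ : Fin P.d) {x x' : HiggsLattice.Site P 0} (hx : x ≠ x') :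
    ‖tau132 C A (μ, x) (μ, x') (dEta C A k f (μ, x')) - dEta C A k f (μ, x)‖ ≤ norm132B C A k α f * dist132 k (μ, x) (μ, x') ^ α := by
  have hpos : 0 < dist132 k ((μ, x) : DIdx P) (μ, x') := by
    unfold dist132
    have h1 : (1 : ℝ) ≤ HiggsLattice.Site.tdist x x' := by exact_mod_cast B3Ineq211RegularTorus.one_le_tdist_of_ne' (Ne.symm hx)
    have hL : (0 : ℝ) < (P.L : ℝ) ^ k := pow_pos (Nat.cast_pos.mpr P.hL) k
    positivity
  have hb := holder_bound (α := α) (adm := SameDir) (dist := dist132 k) (τ := tau132 C A) (S := Finset.univ) (dEta C A k f)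
    (Finset.mem_univ (μ, x)) (Finset.mem_univ (μ, x')) rfl hpos
  refine hb.trans (mul_le_mul_of_nonneg_right ?_ (Real.rpow_nonneg hpos.le α))
  rw [norm132B_eq]
  have h2 := supNorm_nonneg Finset.univ f
  have h3 := supNorm_nonneg Finset.univ (dEta C A k f)
  linarith

end Norm

/-! ## §3 «For external vector fields we have the same definition, but with B̃ = 0» -/

section ZeroField

variable {V : Type*} [NormedAddCommGroup V] [NormedSpace ℝ V] (k : ℕ)

/-- the plain `η`-difference derivative `(∂^η_μF)(x) = η^{−1}(F(x + ηe_μ) − F(x))` of a field with values in a normed space `V`.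
[cite: Balaban1983Higgs3, (1.32) p.420] -/
def dPlain (F : HiggsLattice.Site P 0 → V) : DIdx P → V := fun p => ((P.L : ℝ) ^ k) • (F (p.2.shift p.1) - F p.2)

/-- **(1.32) with `B̃ = 0`** — «For external vector fields we have the same definition, but with B̃ = 0»: plain differences,
identity transports; stated for fields with values in any normed space `V` (an external vector field: its components, `V = ℝ^d`,
or a bond function read at `b₋`). [cite: Balaban1983Higgs3, (1.32) p.420] -/
def norm132V (α : ℝ) (F : HiggsLattice.Site P 0 → V) : ℝ :=
  norm132 α SameDir (dist132 k) (fun _ _ v => v) Finset.univ Finset.univ F (dPlain k F)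

/-- unfolding. [cite: Balaban1983Higgs3, (1.32) p.420] -/
theorem norm132V_eq (α : ℝ) (F : HiggsLattice.Site P 0 → V) :
    norm132V k α F = supNorm Finset.univ F + supNorm Finset.univ (dPlain k F) +
      holderSeminorm α SameDir (dist132 k) (fun _ _ v => v) Finset.univ (dPlain k F) := rfl

/-- `‖F‖_{1,α} ≥ 0`. [cite: Balaban1983Higgs3, (1.32) p.420] -/
theorem norm132V_nonneg (α : ℝ) (F : HiggsLattice.Site P 0 → V) : 0 ≤ norm132V k α F := norm132_nonneg _ _ _ _ _ _ _ _

variable (C : HiggsLattice.ChargeData N)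

/-- at `B̃ = 0` the covariant derivative is the plain one (`U(0) = 1`). [cite: Balaban1983Higgs3, (1.32) p.420] -/
theorem dEta_zero (f : HiggsLattice.ScalarField P 0 N) : dEta C (0 : HiggsLattice.VecField P 0) k f = dPlain k f := by
  funext p
  simp only [dEta, dPlain, Pi.zero_apply, HiggsLattice.ChargeData.U_zero, one_apply_eq_self]

/-- kernel: the pair form of the zero field vanishes. [cite: Balaban1983RegularityDecay, p.572] -/
theorem bondVal_zero (u v : HiggsLattice.Site P 0) : bondVal (0 : HiggsLattice.VecField P 0) u v = 0 := by
  simp [bondVal]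

/-- at `B̃ = 0` every transport is the identity: `U(0(Γ)) = 1`. [cite: Balaban1983Higgs3, (1.32) p.420] -/
theorem hol_zero (x : HiggsLattice.Site P 0) : ∀ l : List (HiggsLattice.Site P 0), hol C (0 : HiggsLattice.VecField P 0) x l = 1
  | [] => hol_nil C 0 x
  | y :: l => by rw [hol_cons, bondVal_zero, HiggsLattice.ChargeData.U_zero, one_mul, hol_zero y l]

/-- hence `tau132 C 0 = id`. [cite: Balaban1983Higgs3, (1.32) p.420] -/
theorem tau132_zero (p q : DIdx P) (v : EuclideanSpace ℝ (Fin N)) : tau132 C (0 : HiggsLattice.VecField P 0) p q v = v := by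
  rw [tau132, hol_zero]; rfl

/-- **`‖f‖_{1,α}[B̃ = 0]` IS the plain norm `norm132V`** (the printed «same definition, but with B̃ = 0», read back on scalar fields).
[cite: Balaban1983Higgs3, (1.32) p.420] -/
theorem norm132B_zero (α : ℝ) (f : HiggsLattice.ScalarField P 0 N) : norm132B C (0 : HiggsLattice.VecField P 0) k α f = norm132V k α f := by
  rw [norm132B, norm132V, dEta_zero]
  congr 1
  funext p q v
  exact tau132_zero C p q v

end ZeroField

/-! ## §4 Gauge invariance of (1.32) at a general `B̃` -/

section Gauge

variable (C : HiggsLattice.ChargeData N) (k : ℕ)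

/-- kernel: the pair form is additive in the field. [cite: Balaban1983RegularityDecay, p.572] -/
theorem bondVal_sub (A B : HiggsLattice.VecField P 0) (u v : HiggsLattice.Site P 0) : bondVal (A - B) u v = bondVal A u v - bondVal B u v := by
  simp only [bondVal, Pi.sub_apply]
  rw [← Finset.sum_sub_distrib]
  refine Finset.sum_congr rfl fun μ _ => ?_
  split_ifs <;> ring

/-- kernel: along a chain the pair forms subtract. [cite: Balaban1983RegularityDecay, p.572] -/
theorem pathSum_bondVal_sub (A B : HiggsLattice.VecField P 0) (x : HiggsLattice.Site P 0) :
    ∀ l : List (HiggsLattice.Site P 0), pathSum (bondVal (A - B)) x l = pathSum (bondVal A) x l - pathSum (bondVal B) x l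
  | [] => by simp [pathSum]
  | y :: l => by rw [pathSum, pathSum, pathSum, pathSum_bondVal_sub A B y l, bondVal_sub]; ring

/-- **the pair form of a gradient on a bond is the difference quotient of the gauge function**: for lattice neighbours `u, v`,
`(∂^ηλ)(u,v) = ε^{−1}(λ(v) − λ(u))` (either orientation; `|T|_μ > 2`). [cite: Balaban1982Higgs1, (1.8) p.605] -/
theorem bondVal_grad_of_tNbr (hS : ∀ μ, 2 < P.sitesPerDir 0 μ) (lam : HiggsLattice.Site P 0 → ℝ) {u v : HiggsLattice.Site P 0} (h : TNbr u v) :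
    bondVal (grad lam) u v = (P.mesh 0)⁻¹ * (lam v - lam u) := by
  obtain ⟨μ, rfl | rfl⟩ := h
  · rw [bondVal_shift hS]; rfl
  · rw [bondVal_of_shift hS, grad]
    change -((P.mesh 0)⁻¹ * (lam (v.shift μ) - lam v)) = _
    ring

/-- **the gradient telescopes along every contour**: `(∂^ηλ)(Γ) = ε^{−1}(λ(end Γ) − λ(x))`. [cite: Balaban1982Higgs1, (1.8) p.605] -/
theorem pathSum_bondVal_grad (hS : ∀ μ, 2 < P.sitesPerDir 0 μ) (lam : HiggsLattice.Site P 0 → ℝ) {x : HiggsLattice.Site P 0} :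
    ∀ {l : List (HiggsLattice.Site P 0)}, IsTChain x l → pathSum (bondVal (grad lam)) x l = (P.mesh 0)⁻¹ * (lam (pathEnd x l) - lam x)
  | [], _ => by simp [pathSum, pathEnd]
  | y :: l, hl => by
    rw [pathSum, pathEnd, bondVal_grad_of_tNbr hS lam hl.1, pathSum_bondVal_grad hS lam hl.2]
    ring

/-- **the transport under a gauge transformation**: `U((B̃ − ∂^ηλ)(Γ)) = U(λ(x))·U(B̃(Γ))·U(−λ(end Γ))` (abelian links commute).
[cite: Balaban1982Higgs1, (1.7) p.605] -/
theorem hol_gaugeVec (hS : ∀ μ, 2 < P.sitesPerDir 0 μ) (lam : HiggsLattice.Site P 0 → ℝ) (A : HiggsLattice.VecField P 0) {x : HiggsLattice.Site P 0}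
    {l : List (HiggsLattice.Site P 0)} (hl : IsTChain x l) :
    hol C (gaugeVec lam A) x l =
      C.U (P.mesh 0) ((P.mesh 0)⁻¹ * lam x) * hol C A x l * C.U (P.mesh 0) (-((P.mesh 0)⁻¹ * lam (pathEnd x l))) := by
  rw [hol, hol, gaugeVec, pathSum_bondVal_sub, pathSum_bondVal_grad hS lam hl, ← HiggsLattice.ChargeData.U_add, ← HiggsLattice.ChargeData.U_add]
  congr 1
  ring

/-- applied form with `U(−θ)U(θ)w = w`: `U((B̃ − ∂λ)(Γ))(U(λ(end))w) = U(λ(x))(U(B̃(Γ))w)`. [cite: Balaban1982Higgs1, (1.7) p.605] -/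
theorem hol_gaugeVec_apply (hS : ∀ μ, 2 < P.sitesPerDir 0 μ) (lam : HiggsLattice.Site P 0 → ℝ) (A : HiggsLattice.VecField P 0) {x : HiggsLattice.Site P 0}
    {l : List (HiggsLattice.Site P 0)} (hl : IsTChain x l) (w : EuclideanSpace ℝ (Fin N)) :
    hol C (gaugeVec lam A) x l (C.U (P.mesh 0) ((P.mesh 0)⁻¹ * lam (pathEnd x l)) w) =
      C.U (P.mesh 0) ((P.mesh 0)⁻¹ * lam x) (hol C A x l w) := by
  rw [hol_gaugeVec C hS lam A hl]
  change C.U (P.mesh 0) ((P.mesh 0)⁻¹ * lam x) (hol C A x l (C.U (P.mesh 0) (-((P.mesh 0)⁻¹ * lam (pathEnd x l)))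
    (C.U (P.mesh 0) ((P.mesh 0)⁻¹ * lam (pathEnd x l)) w))) = _
  rw [B1TorusChainTransport.U_neg_U_apply]

/-- **`D^η` is gauge covariant in `η`-units**: `D^η_{B̃−∂λ}(U(λ)f)(μ,x) = U(λ(x))·D^η_{B̃}f(μ,x)` (typer's `covDeriv_gauge`).
[cite: Balaban1982Higgs1, (1.7) p.605] -/
theorem dEta_gauge (lam : HiggsLattice.Site P 0 → ℝ) (A : HiggsLattice.VecField P 0) (f : HiggsLattice.ScalarField P 0 N) (p : DIdx P) :
    dEta C (gaugeVec lam A) k (rot C lam f) p = C.U (P.mesh 0) ((P.mesh 0)⁻¹ * lam p.2) (dEta C A k f p) := by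
  rw [dEta_eq_smul_covDeriv, dEta_eq_smul_covDeriv, covDeriv_gauge, ContinuousLinearMap.map_smul]

/-- kernel: the sup part of (1.32) depends only on the sitewise norms (as in p03's `B3Norm132ConstGauge`, private there).
[cite: Balaban1983Higgs3, (1.32) p.420] -/
private theorem supNorm_congr {ι W : Type*} [SeminormedAddCommGroup W] {S : Finset ι} {f g : ι → W} (h : ∀ i, ‖f i‖ = ‖g i‖) :
    supNorm S f = supNorm S g := by
  unfold LatticeNorms.supNorm
  have hn : ∀ i, ‖f i‖₊ = ‖g i‖₊ := fun i => NNReal.eq (by simpa using h i)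
  simp_rw [hn]

/-- kernel: the Hölder part of (1.32) depends only on the norms of the transported differences (as in p03's file, private there).
[cite: Balaban1983Higgs3, (1.32) p.420] -/
private theorem holderSeminorm_congr {ι W : Type*} [SeminormedAddCommGroup W] {α : ℝ} {adm : ι → ι → Prop} {dist : ι → ι → ℝ}
    {τ τ' : ι → ι → W → W} {S : Finset ι} {f g : ι → W} (h : ∀ p q, ‖τ p q (f q) - f p‖ = ‖τ' p q (g q) - g p‖) :
    holderSeminorm α adm dist τ S f = holderSeminorm α adm dist τ' S g := by
  unfold LatticeNorms.holderSeminorm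
  have hn : ∀ p q, ‖τ p q (f q) - f p‖₊ = ‖τ' p q (g q) - g p‖₊ := fun p q => NNReal.eq (by simpa using h p q)
  simp_rw [hn]

/-- the transported Hölder difference is gauge COVARIANT: `U((B̃−∂λ)(Γ_{x,x′}))D′(x′) − D′(x) = U(λ(x))[U(B̃(Γ_{x,x′}))D(x′) − D(x)]`
with `D = D^η_{B̃,μ}f`, `D′ = D^η_{B̃−∂λ,μ}(U(λ)f)`. [cite: Balaban1983Higgs3, p.433] -/
theorem tau132_dEta_gauge (hS : ∀ μ, 2 < P.sitesPerDir 0 μ) (lam : HiggsLattice.Site P 0 → ℝ) (A : HiggsLattice.VecField P 0) (f : HiggsLattice.ScalarField P 0 N)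
    (p q : DIdx P) :
    tau132 C (gaugeVec lam A) p q (dEta C (gaugeVec lam A) k (rot C lam f) q) - dEta C (gaugeVec lam A) k (rot C lam f) p =
      C.U (P.mesh 0) ((P.mesh 0)⁻¹ * lam p.2) (tau132 C A p q (dEta C A k f q) - dEta C A k f p) := by
  have hend : pathEnd p.2 (cpath p.2 q.2) = q.2 := pathEnd_cpath p.2 q.2
  rw [dEta_gauge, dEta_gauge, tau132, tau132, map_sub, ← hol_gaugeVec_apply C hS lam A (isTChain_cpath p.2 q.2).1, hend]

/-- **GAUGE INVARIANCE OF (1.32)**: `‖U(λ)f‖_{1,α}[B̃ − ∂^ηλ] = ‖f‖_{1,α}[B̃]` for every background `B̃`, every gauge function `λ` on the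
torus and every `α` — each of the three suprema is preserved (`U` unitary).  Print uses this at the CONSTANT field `B̃₀` (p. 433 «gauge-
invariant with respect to gauge transformations of the field B̃₀, if the external scalar fields are simultaneously transformed»,
p. 434 «these norms are equal to the norms defined by (1.32) with B̃ = B̃₀»); the statement at a general `B̃` is our located
generalization of that mechanism, not a printed claim. [cite: Balaban1983Higgs3, p.433] -/
theorem norm132B_gauge (hS : ∀ μ, 2 < P.sitesPerDir 0 μ) (lam : HiggsLattice.Site P 0 → ℝ) (A : HiggsLattice.VecField P 0) (α : ℝ) (f : HiggsLattice.ScalarField P 0 N) :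
    norm132B C (gaugeVec lam A) k α (rot C lam f) = norm132B C A k α f := by
  rw [norm132B_eq, norm132B_eq]
  have h1 : supNorm Finset.univ (rot C lam f) = supNorm Finset.univ f :=
    supNorm_congr fun x => norm_U C _ _ _
  have h2 : supNorm Finset.univ (dEta C (gaugeVec lam A) k (rot C lam f)) = supNorm Finset.univ (dEta C A k f) :=
    supNorm_congr fun p => by rw [dEta_gauge, norm_U]
  have h3 : holderSeminorm α SameDir (dist132 k) (tau132 C (gaugeVec lam A)) Finset.univ (dEta C (gaugeVec lam A) k (rot C lam f)) =
      holderSeminorm α SameDir (dist132 k) (tau132 C A) Finset.univ (dEta C A k f) :=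
    holderSeminorm_congr fun p q => by rw [tau132_dEta_gauge C k hS, norm_U]
  rw [h1, h2, h3]

end Gauge

end

end Literature.MathematicalPhysics.QuantumFieldTheory.Balaban1983to89.B3Norm132Covariant
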